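import Literature.AlgebraicGeometry.Resolution.BlowupChartModule
import Literature.RingTheory.LocalCohomology.KawasakiChartStep
import Mathlib.RingTheory.Localization.Away.Basic
import Mathlib.RingTheory.FiniteType
import HarnessLib

/-!
# From the chart `R[I/g]` to the chart `R[IJ/gb]`: Kawasaki's inductive step on chart modules

Topic: `Literature/AlgebraicGeometry/Resolution`, sequel of `BlowupChartModule.lean` and of
`Literature/RingTheory/LocalCohomology/KawasakiChartStep.lean`. By Stacks 080A,
`Bl_{I·J}(X) = Bl_J(Bl_I(X))`; on charts, for `g ∈ I` and `b ∈ J`,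

`R[IJ/gb] = R[I/g][J R[I/g] / b] ⊆ R[1/gb]`,

and correspondingly for the chart modules of an `R`-module `M` (Česnavičius 2021, (3.12.2)):
`M_{(gb)} = R[IJ/gb] · M ⊆ M[1/gb]` is the `R[I/g][T]`-span (`T ↦ a/b`) of the image of
`M_{(g)} = R[I/g] · M ⊆ M[1/g]`, as soon as `J · R[I/g] = (a, b) R[I/g]`. This file sets up the
transition `R[1/g] → R[1/gb]`, `R[I/g] → R[IJ/gb]`, `M[1/g] → M[1/gb]` and proves:

* `finiteType_blowupAlgebra`, `isNoetherianRing_blowupAlgebra_of_isNoetherianRing` — `R[I/g]`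
  is of finite type over `R` (for `I` finitely generated), hence Noetherian for `R` Noetherian;
* `awayMul_mem_blowupAlgebra`, `blowupAlgebraMul` — `R[I/g] → R[IJ/gb]`;
* `rho`, `rho_surjective` — **the surjection `R[I/g][T] ↠ R[IJ/gb]`, `T ↦ a/b`**, when
  `J R[I/g] ⊆ (a, b) R[I/g]` (Stacks 080A on this chart);
* `awayMulMod` — `M[1/g] → M[1/gb]` and its linearity over `R[1/g] → R[1/gb]`;
* `span_kappa_eq` — **`R[I/g][T] · (image of M_{(g)}) = M_{(gb)}`** inside `M[1/gb]`;
* `cechVanishBelow_chartModule_mul` — **the inductive step of Kawasaki's theorem on chart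
  modules**: the conclusion of `cechVanishBelow_span_of_chart` (Česnavičius 2021, proof of
  Thm. 3.13) for `N = M_{(g)}`, read on the `R[IJ/gb]`-module `M_{(gb)}` with respect to any family
  of elements of `R[IJ/gb]` generating the image of `(f, y)`.

Everything is proved; no named facts.

## References

* [StacksProject] The Stacks Project, Tag 080A (blowing up in a product of ideals), Tag 0804.
* [Cesnavicius2021] K. Česnavičius, *Macaulayfication of Noetherian schemes*, Duke Math. J. 170
  (2021), §3.12 ((3.12.1)–(3.12.2)) and proof of Thm. 3.13.
* [Kawasaki2000] T. Kawasaki, *On Macaulayfication of Noetherian schemes*, Trans. AMS 352 (2000),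
  §4 (p. 2532, the tower `Y_{s,1} → Y_{s,2} → ⋯`).
-/

noncomputable section

open IsLocalization Polynomial Pointwise Literature.RingTheory.LocalCohomology

namespace Literature.AlgebraicGeometry.Resolution

universe u

variable {R : Type u} [CommRing R] (I J : Ideal R) (g b a : R)

/-! ## `R[I/g]` is of finite type -/

/-- `R[I/g]` is generated by the `x/g` for `x` in any generating set of `I`.
[cite: GortzWedhorn2020, (13.19) p. 415] -/
theorem blowupAlgebra_eq_adjoin_of_span_eq {S : Set R} (hS : Ideal.span S = I) :
    blowupAlgebra I g = Algebra.adjoin R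
      ((fun x => algebraMap R (Localization.Away g) x * Away.invSelf g) '' S) := by
  apply le_antisymm
  · refine Algebra.adjoin_le ?_
    rintro _ ⟨x, hx, rfl⟩
    rw [← hS] at hx
    refine Submodule.span_induction (p := fun x _ =>
        algebraMap R (Localization.Away g) x * Away.invSelf g ∈ Algebra.adjoin R
          ((fun x => algebraMap R (Localization.Away g) x * Away.invSelf g) '' S)) ?_ ?_ ?_ ?_ hx
    · intro x hx
      exact Algebra.subset_adjoin ⟨x, hx, rfl⟩
    · rw [map_zero, zero_mul]; exact Subalgebra.zero_mem _
    · intro x y _ _ hx hy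
      rw [map_add, add_mul]; exact Subalgebra.add_mem _ hx hy
    · intro r x _ hx
      rw [smul_eq_mul, map_mul, mul_assoc]
      exact Subalgebra.mul_mem _ (Subalgebra.algebraMap_mem _ r) hx
  · refine Algebra.adjoin_le ?_
    rintro _ ⟨x, hx, rfl⟩
    exact div_mem_blowupAlgebra I g (hS ▸ Ideal.subset_span hx)

/-- **`R[I/g]` is of finite type over `R`** for `I` finitely generated.
[cite: GortzWedhorn2020, (13.19) p. 415] -/
theorem finiteType_blowupAlgebra (hI : I.FG) : Algebra.FiniteType R (blowupAlgebra I g) := by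
  obtain ⟨S, hS⟩ := hI
  rw [blowupAlgebra_eq_adjoin_of_span_eq I g hS]
  classical
  refine (Subalgebra.fg_iff_finiteType _).mp ⟨S.image fun x =>
    algebraMap R (Localization.Away g) x * Away.invSelf g, ?_⟩
  rw [Finset.coe_image]

/-- `R[I/g]` is Noetherian if `R` is. [folklore] -/
theorem isNoetherianRing_blowupAlgebra_of_isNoetherianRing [IsNoetherianRing R] :
    IsNoetherianRing (blowupAlgebra I g) :=
  haveI := finiteType_blowupAlgebra I g (IsNoetherian.noetherian I)
  Algebra.FiniteType.isNoetherianRing R _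

/-! ## The transition `R[1/g] → R[1/gb]` -/

/-- The canonical map `R[1/g] → R[1/gb]`. [cite: StacksProject, Tag 080A] -/
abbrev awayMul : Localization.Away g →+* Localization.Away (g * b) :=
  IsLocalization.Away.awayToAwayRight g b

/-- `awayMul` is an `R`-algebra map. [folklore] -/
theorem awayMul_algebraMap (r : R) :
    awayMul g b (algebraMap R (Localization.Away g) r) = algebraMap R (Localization.Away (g * b)) r :=
  IsLocalization.Away.awayToAwayRight_eq g b r

/-- `g` is a unit of `R[1/gb]`. [folklore] -/
theorem isUnit_algebraMap_left :
    IsUnit (algebraMap R (Localization.Away (g * b)) g) :=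
  IsLocalization.Away.isUnit_of_dvd (g * b) (dvd_mul_right g b)

/-- `b` is a unit of `R[1/gb]`. [folklore] -/
theorem isUnit_algebraMap_right :
    IsUnit (algebraMap R (Localization.Away (g * b)) b) :=
  IsLocalization.Away.isUnit_of_dvd (g * b) (dvd_mul_left b g)

/-- `awayMul (1/g) = b/(gb)`. [folklore] -/
theorem awayMul_invSelf :
    awayMul g b (Away.invSelf g) =
      algebraMap R (Localization.Away (g * b)) b * Away.invSelf (g * b) := by
  have hL : awayMul g b (Away.invSelf g) * algebraMap R (Localization.Away (g * b)) g = 1 := by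
    rw [← awayMul_algebraMap g b g, ← map_mul, mul_comm (Away.invSelf g), Away.mul_invSelf, map_one]
  have hR : algebraMap R (Localization.Away (g * b)) b * Away.invSelf (g * b) *
      algebraMap R (Localization.Away (g * b)) g = 1 := by
    rw [mul_assoc, mul_comm (Away.invSelf (g * b)), ← mul_assoc, ← map_mul, mul_comm b g,
      Away.mul_invSelf]
  rw [← (isUnit_algebraMap_left g b).mul_left_inj, hL, hR]

/-- `awayMul (1/g)ⁿ = (b/(gb))ⁿ`. [folklore] -/
theorem awayMul_invSelf_pow (n : ℕ) :
    awayMul g b (Away.invSelf g ^ n) =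
      algebraMap R (Localization.Away (g * b)) (b ^ n) * Away.invSelf (g * b) ^ n := by
  rw [map_pow, awayMul_invSelf, mul_pow, map_pow]

/-- `awayMul (r/gⁿ) = r bⁿ/(gb)ⁿ` on `Localization.mk`. [folklore] -/
theorem awayMul_mk (r : R) (n : ℕ) :
    awayMul g b (Localization.mk r (⟨g ^ n, n, rfl⟩ : Submonoid.powers g)) =
      Localization.mk (r * b ^ n) (⟨(g * b) ^ n, n, rfl⟩ : Submonoid.powers (g * b)) := by
  have key : ∀ (c : R) (n : ℕ) (r : R), Localization.mk r (⟨c ^ n, n, rfl⟩ : Submonoid.powers c) =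
      algebraMap R (Localization.Away c) r * Away.invSelf c ^ n := by
    intro c n r
    have hu : IsUnit (algebraMap R (Localization.Away c) (c ^ n)) := by
      rw [map_pow]; exact (IsLocalization.Away.algebraMap_isUnit c).pow n
    rw [← hu.mul_left_inj, Localization.mk_eq_mk', IsLocalization.mk'_spec, mul_assoc,
      mul_comm (Away.invSelf c ^ n), algebraMap_pow_mul_invSelf_pow, mul_one]
  rw [key, key, map_mul, awayMul_algebraMap, awayMul_invSelf_pow, map_mul, mul_assoc]

/-- **`R[1/g] → R[1/gb]` maps `R[I/g]` into `R[IJ/gb]`** for `b ∈ J`: `x/g ↦ xb/(gb)`.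
[cite: StacksProject, Tag 080A] -/
theorem awayMul_mem_blowupAlgebra (hb : b ∈ J) {z : Localization.Away g}
    (hz : z ∈ blowupAlgebra I g) : awayMul g b z ∈ blowupAlgebra (I * J) (g * b) := by
  induction hz using Algebra.adjoin_induction with
  | mem z hz =>
    obtain ⟨x, hx, rfl⟩ := hz
    rw [map_mul, awayMul_algebraMap, awayMul_invSelf, ← mul_assoc, ← map_mul]
    exact div_mem_blowupAlgebra _ _ (Ideal.mul_mem_mul hx hb)
  | algebraMap r => rw [awayMul_algebraMap]; exact Subalgebra.algebraMap_mem _ r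
  | add z z' _ _ ih ih' => rw [map_add]; exact Subalgebra.add_mem _ ih ih'
  | mul z z' _ _ ih ih' => rw [map_mul]; exact Subalgebra.mul_mem _ ih ih'

/-- **The transition `R[I/g] → R[IJ/gb]`.** [cite: StacksProject, Tag 080A] -/
def blowupAlgebraMul (hb : b ∈ J) : blowupAlgebra I g →+* blowupAlgebra (I * J) (g * b) :=
  ((awayMul g b).comp (blowupAlgebra I g).subtype).codRestrict _
    fun z => awayMul_mem_blowupAlgebra I J g b hb z.2

/-- `blowupAlgebraMul` on elements. [folklore] -/
@[simp]
theorem coe_blowupAlgebraMul (hb : b ∈ J) (z : blowupAlgebra I g) :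
    (blowupAlgebraMul I J g b hb z : Localization.Away (g * b)) = awayMul g b z := rfl

/-- The element `a/b = ag/(gb) ∈ R[1/gb]`. [cite: StacksProject, Tag 080A] -/
def aOverB : Localization.Away (g * b) :=
  algebraMap R (Localization.Away (g * b)) (g * a) * Away.invSelf (g * b)

/-- `(a/b) · b = a`. [folklore] -/
theorem aOverB_mul_algebraMap :
    aOverB g b a * algebraMap R (Localization.Away (g * b)) b =
      algebraMap R (Localization.Away (g * b)) a := by
  rw [aOverB, mul_comm g a, map_mul, mul_assoc, mul_assoc, mul_comm (Away.invSelf _), ← mul_assoc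
    (algebraMap R _ g), ← map_mul, Away.mul_invSelf, mul_one]

/-- `a/b ∈ R[IJ/gb]` for `g ∈ I`, `a ∈ J`. [cite: StacksProject, Tag 080A] -/
theorem aOverB_mem (hg : g ∈ I) (ha : a ∈ J) : aOverB g b a ∈ blowupAlgebra (I * J) (g * b) :=
  div_mem_blowupAlgebra _ _ (Ideal.mul_mem_mul hg ha)

/-- The substitution `R[I/g][T] → R[1/gb]`, `T ↦ a/b` (no hypotheses). [cite: StacksProject, Tag 080A] -/
def chi : (blowupAlgebra I g)[X] →+* Localization.Away (g * b) :=
  Polynomial.eval₂RingHom ((awayMul g b).comp (blowupAlgebra I g).subtype) (aOverB g b a)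

/-- `χ` on constants. [folklore] -/
theorem chi_C (z : blowupAlgebra I g) : chi I g b a (C z) = awayMul g b z := by
  rw [chi, Polynomial.coe_eval₂RingHom, Polynomial.eval₂_C]; rfl

/-- `χ(T) = a/b`. [folklore] -/
theorem chi_X : chi I g b a X = aOverB g b a := by
  rw [chi, Polynomial.coe_eval₂RingHom, Polynomial.eval₂_X]

/-- **The surjection `ρ : R[I/g][T] ↠ R[IJ/gb]`, `T ↦ a/b`.** [cite: StacksProject, Tag 080A] -/
def rho (hg : g ∈ I) (hb : b ∈ J) (ha : a ∈ J) :
    (blowupAlgebra I g)[X] →+* blowupAlgebra (I * J) (g * b) :=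
  Polynomial.eval₂RingHom (blowupAlgebraMul I J g b hb) ⟨aOverB g b a, aOverB_mem I J g b a hg ha⟩

/-- `ρ` on constants. [folklore] -/
theorem rho_C (hg : g ∈ I) (hb : b ∈ J) (ha : a ∈ J) (z : blowupAlgebra I g) :
    rho I J g b a hg hb ha (C z) = blowupAlgebraMul I J g b hb z := by
  rw [rho, Polynomial.coe_eval₂RingHom, Polynomial.eval₂_C]

/-- `ρ(T) = a/b`. [folklore] -/
theorem coe_rho_X (hg : g ∈ I) (hb : b ∈ J) (ha : a ∈ J) :
    (rho I J g b a hg hb ha X : Localization.Away (g * b)) = aOverB g b a := by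
  rw [rho, Polynomial.coe_eval₂RingHom, Polynomial.eval₂_X]

/-- `ρ` followed by the inclusion `R[IJ/gb] ⊆ R[1/gb]` is `χ`. [folklore] -/
theorem subtype_comp_rho (hg : g ∈ I) (hb : b ∈ J) (ha : a ∈ J) :
    ((blowupAlgebra (I * J) (g * b)).val : _ →+* Localization.Away (g * b)).comp
      (rho I J g b a hg hb ha) = chi I g b a := by
  refine Polynomial.ringHom_ext (fun z => ?_) ?_
  · rw [RingHom.comp_apply, rho_C, chi_C]; rfl
  · rw [RingHom.comp_apply, chi_X]; exact coe_rho_X I J g b a hg hb ha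

/-- `ρ` and `χ` agree elementwise. [folklore] -/
theorem coe_rho (hg : g ∈ I) (hb : b ∈ J) (ha : a ∈ J) (p : (blowupAlgebra I g)[X]) :
    (rho I J g b a hg hb ha p : Localization.Away (g * b)) = chi I g b a p := by
  rw [← subtype_comp_rho I J g b a hg hb ha]; rfl

/-- **`ρ` is onto when `J R[I/g] ⊆ (a, b) R[I/g]`** (each `z ∈ J` is `α a + β b` in `R[I/g]`):
then `R[IJ/gb] = R[I/g][a/b]`. [cite: StacksProject, Tag 080A]
[cite: Cesnavicius2021, proof of Thm. 3.13 ("`(r_1, …, r_s)R' = (r_a, r_b)R'`")] -/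
theorem rho_surjective (hg : g ∈ I) (hb : b ∈ J) (ha : a ∈ J)
    (hJ : ∀ z ∈ J, ∃ α β : blowupAlgebra I g, algebraMap R (blowupAlgebra I g) z =
      α * algebraMap R (blowupAlgebra I g) a + β * algebraMap R (blowupAlgebra I g) b) :
    Function.Surjective (rho I J g b a hg hb ha) := by
  have key : ∀ w ∈ blowupAlgebra (I * J) (g * b),
      ∃ p, (rho I J g b a hg hb ha p : Localization.Away (g * b)) = w := by
    intro w hw
    induction hw using Algebra.adjoin_induction with
    | mem z hz =>
      obtain ⟨y, hy, rfl⟩ := hz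
      refine Submodule.mul_induction_on hy (fun x hx z hz => ?_) (fun y y' ih ih' => ?_)
      · obtain ⟨α, β, hαβ⟩ := hJ z hz
        -- `xz/(gb) = (x/g) · (z/b) = (x/g) · (α a/b + β)`
        refine ⟨C (blowupAlgebra.divPow I g (n := 1) (y := x) (by rwa [pow_one])) *
          (C α * X + C β), ?_⟩
        have hz' : algebraMap R (Localization.Away (g * b)) z =
            awayMul g b α * algebraMap R _ a + awayMul g b β * algebraMap R _ b := by
          have := congrArg (fun w : blowupAlgebra I g => awayMul g b (w : Localization.Away g)) hαβ
          simpa only [Subalgebra.coe_algebraMap, Subalgebra.coe_add, Subalgebra.coe_mul, map_add,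
            map_mul, awayMul_algebraMap] using this
        rw [coe_rho, map_mul, map_add, map_mul, chi_C, chi_C, chi_C, chi_X,
          blowupAlgebra.coe_divPow, pow_one, map_mul, awayMul_algebraMap, awayMul_invSelf,
          map_mul, hz', ← aOverB_mul_algebraMap g b a]
        ring
      · obtain ⟨p, hp⟩ := ih
        obtain ⟨p', hp'⟩ := ih'
        exact ⟨p + p', by rw [map_add, Subalgebra.coe_add, hp, hp', map_add, add_mul]⟩
    | algebraMap r =>
      exact ⟨C (algebraMap R _ r), by
        rw [coe_rho, chi_C, Subalgebra.coe_algebraMap, awayMul_algebraMap]⟩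
    | add z z' _ _ ih ih' =>
      obtain ⟨p, hp⟩ := ih
      obtain ⟨p', hp'⟩ := ih'
      exact ⟨p + p', by rw [map_add, Subalgebra.coe_add, hp, hp']⟩
    | mul z z' _ _ ih ih' =>
      obtain ⟨p, hp⟩ := ih
      obtain ⟨p', hp'⟩ := ih'
      exact ⟨p * p', by rw [map_mul, Subalgebra.coe_mul, hp, hp']⟩
  intro w
  obtain ⟨p, hp⟩ := key w w.2
  exact ⟨p, Subtype.ext hp⟩

/-! ## The transition on modules: `M[1/g] → M[1/gb]` -/

section Modules

variable (E : Type u) [AddCommGroup E] [Module R E]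

/-- `M[1/gb]` as an `R[1/g]`-module, along `R[1/g] → R[1/gb]`. [cite: StacksProject, Tag 080A] -/
@[reducible]
def awayMulModule : Module (Localization.Away g) (LocalizedModule (Submonoid.powers (g * b)) E) :=
  Module.compHom _ (awayMul g b)

attribute [local instance] awayMulModule

/-- Unfolding the `R[1/g]`-action on `M[1/gb]`. [folklore] -/
theorem awayMul_smul_def (w : Localization.Away g) (x : LocalizedModule (Submonoid.powers (g * b)) E) :
    w • x = awayMul g b w • x := rfl

/-- The `R[1/g]`-action on `M[1/gb]` is compatible with the `R`-action. [folklore] -/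
theorem isScalarTower_awayMul :
    IsScalarTower R (Localization.Away g) (LocalizedModule (Submonoid.powers (g * b)) E) :=
  ⟨fun r w x => by
    have h1 : (r • w) • x = awayMul g b (r • w) • x := rfl
    have h2 : w • x = awayMul g b w • x := rfl
    rw [h1, h2, Algebra.smul_def, map_mul, awayMul_algebraMap, mul_smul, algebraMap_smul]⟩

attribute [local instance] isScalarTower_awayMul

/-- The action of `z ∈ R[I/g]` on `M[1/gb]`. [folklore] -/
theorem blowupAlgebra_smul_def' (z : blowupAlgebra I g) (x : LocalizedModule (Submonoid.powers (g * b)) E) :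
    z • x = awayMul g b (z : Localization.Away g) • x := by
  have h : z • x = (z : Localization.Away g) • x := rfl
  rw [h]; rfl

/-- `M[1/gb]` as an `R[I/g][T]`-module, `T` acting as `a/b` (along `χ`; this depends on the
choice of `a`, so it is only ever a local instance inside proofs). [cite: StacksProject, Tag 080A] -/
@[reducible]
def chiModule : Module (blowupAlgebra I g)[X] (LocalizedModule (Submonoid.powers (g * b)) E) :=
  Module.compHom _ (chi I g b a)

/-- Unfolding the `R[I/g][T]`-action on `M[1/gb]`. [folklore] -/
theorem chi_smul_def (p : (blowupAlgebra I g)[X]) (x : LocalizedModule (Submonoid.powers (g * b)) E) :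
    letI := chiModule I g b a E
    p • x = chi I g b a p • x := rfl

/-- The `R[I/g][T]`-action on `M[1/gb]` is compatible with the `R[I/g]`-action. [folklore] -/
theorem isScalarTower_chi :
    letI := chiModule I g b a E
    IsScalarTower (blowupAlgebra I g) (blowupAlgebra I g)[X]
      (LocalizedModule (Submonoid.powers (g * b)) E) := by
  letI := chiModule I g b a E
  exact ⟨fun z p x => by
    rw [chi_smul_def, chi_smul_def, blowupAlgebra_smul_def', Polynomial.smul_eq_C_mul, map_mul,
      chi_C, mul_smul]⟩

/-- Divisors of powers of `gb` act invertibly on `M[1/gb]`. [folklore] -/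
theorem isUnit_algebraMap_end_of_dvd {r : R} {n : ℕ} (h : r ∣ (g * b) ^ n) :
    IsUnit (algebraMap R (Module.End R (LocalizedModule (Submonoid.powers (g * b)) E)) r) := by
  obtain ⟨r', hr'⟩ := h
  have hu := IsLocalizedModule.map_units (LocalizedModule.mkLinearMap (Submonoid.powers (g * b)) E)
    (⟨(g * b) ^ n, n, rfl⟩ : Submonoid.powers (g * b))
  change IsUnit (algebraMap R (Module.End R _) ((g * b) ^ n)) at hu
  rw [hr', map_mul] at hu
  exact ((Commute.map (Commute.all r r') _).isUnit_mul_iff.mp hu).1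

/-- **The transition `τ : M[1/g] → M[1/gb]`.** [cite: StacksProject, Tag 080A] -/
def awayMulMod : LocalizedModule (Submonoid.powers g) E →ₗ[R]
    LocalizedModule (Submonoid.powers (g * b)) E :=
  IsLocalizedModule.lift (Submonoid.powers g) (LocalizedModule.mkLinearMap (Submonoid.powers g) E)
    (LocalizedModule.mkLinearMap (Submonoid.powers (g * b)) E)
    fun s => by
      obtain ⟨_, n, rfl⟩ := s
      exact isUnit_algebraMap_end_of_dvd g b E (pow_dvd_pow_of_dvd (dvd_mul_right g b) n)

/-- `τ (m/1) = m/1`. [folklore] -/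
theorem awayMulMod_mkLinearMap (m : E) :
    awayMulMod g b E (LocalizedModule.mkLinearMap (Submonoid.powers g) E m) =
      LocalizedModule.mkLinearMap (Submonoid.powers (g * b)) E m :=
  IsLocalizedModule.lift_apply _ _ _ _ m

/-- `gⁿ • (m/gⁿ) = m/1`. [folklore] -/
theorem pow_smul_mk_pow (c : R) (m : E) (n : ℕ) :
    c ^ n • LocalizedModule.mk m (⟨c ^ n, n, rfl⟩ : Submonoid.powers c) =
      LocalizedModule.mkLinearMap (Submonoid.powers c) E m := by
  rw [LocalizedModule.mkLinearMap_apply, LocalizedModule.smul'_mk,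
    ← LocalizedModule.mk_cancel (⟨c ^ n, n, rfl⟩ : Submonoid.powers c) m]
  rfl

/-- **`τ (m/gⁿ) = bⁿ m/(gb)ⁿ`.** [cite: StacksProject, Tag 080A] -/
theorem awayMulMod_mk (m : E) (n : ℕ) :
    awayMulMod g b E (LocalizedModule.mk m (⟨g ^ n, n, rfl⟩ : Submonoid.powers g)) =
      LocalizedModule.mk (b ^ n • m) (⟨(g * b) ^ n, n, rfl⟩ : Submonoid.powers (g * b)) := by
  apply smul_injective_of_dvd_pow (g * b) E (pow_dvd_pow_of_dvd (dvd_mul_right g b) n)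
  dsimp only
  rw [← LinearMap.map_smul, pow_smul_mk_pow, awayMulMod_mkLinearMap, LocalizedModule.smul'_mk,
    smul_smul, ← mul_pow, ← LocalizedModule.smul'_mk, pow_smul_mk_pow]

/-- **`τ` is linear over `R[1/g] → R[1/gb]`.** [folklore] -/
theorem awayMulMod_smul (w : Localization.Away g) (x : LocalizedModule (Submonoid.powers g) E) :
    awayMulMod g b E (w • x) = w • awayMulMod g b E x := by
  induction x using LocalizedModule.induction_on with
  | h m s =>
    obtain ⟨_, n, rfl⟩ := s
    induction w using Localization.induction_on with
    | H p =>
      obtain ⟨r, _, k, rfl⟩ := p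
      have hst : ((⟨g ^ k, k, rfl⟩ : Submonoid.powers g) * ⟨g ^ n, n, rfl⟩) =
          ⟨g ^ (k + n), k + n, rfl⟩ := Subtype.ext (pow_add g k n).symm
      have hst' : ((⟨(g * b) ^ k, k, rfl⟩ : Submonoid.powers (g * b)) * ⟨(g * b) ^ n, n, rfl⟩) =
          ⟨(g * b) ^ (k + n), k + n, rfl⟩ := Subtype.ext (pow_add (g * b) k n).symm
      rw [LocalizedModule.mk_smul_mk, hst, awayMulMod_mk, awayMul_smul_def, awayMul_mk,
        awayMulMod_mk, LocalizedModule.mk_smul_mk, hst', smul_smul, smul_smul, pow_add]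
      congr 1
      dsimp only
      ring

/-- `τ` is `R[I/g]`-linear. [folklore] -/
theorem awayMulMod_smul' (z : blowupAlgebra I g) (x : LocalizedModule (Submonoid.powers g) E) :
    awayMulMod g b E (z • x) = z • awayMulMod g b E x :=
  awayMulMod_smul g b E (z : Localization.Away g) x

/-- **`τ` maps `M_{(g)}` into `M_{(gb)}`.** [cite: Cesnavicius2021, §3.12 ((3.12.2))] -/
theorem awayMulMod_mem_chartModule (hb : b ∈ J) {x : LocalizedModule (Submonoid.powers g) E}
    (hx : x ∈ chartModule I g E) : awayMulMod g b E x ∈ chartModule (I * J) (g * b) E := by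
  induction hx using Submodule.span_induction with
  | mem x hx =>
    obtain ⟨m, rfl⟩ := hx
    rw [awayMulMod_mkLinearMap]
    exact mkLinearMap_mem_chartModule _ _ m
  | zero => rw [map_zero]; exact Submodule.zero_mem _
  | add x x' _ _ ih ih' => rw [map_add]; exact Submodule.add_mem _ ih ih'
  | smul z x _ ih =>
    rw [awayMulMod_smul', blowupAlgebra_smul_def', ← coe_blowupAlgebraMul I J g b hb,
      ← blowupAlgebra.smul_def]
    exact Submodule.smul_mem _ _ ih

/-- The kernel of `τ` is `b`-power torsion: `τ x = 0` forces `bʲ x = 0` for some `j`.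
[folklore] -/
theorem exists_pow_smul_eq_zero_of_awayMulMod_eq_zero {x : LocalizedModule (Submonoid.powers g) E}
    (hx : awayMulMod g b E x = 0) : ∃ j : ℕ, b ^ j • x = 0 := by
  induction x using LocalizedModule.induction_on with
  | h m s =>
    obtain ⟨_, n, rfl⟩ := s
    rw [awayMulMod_mk, ← LocalizedModule.zero_mk 1, LocalizedModule.mk_eq] at hx
    obtain ⟨⟨_, j, rfl⟩, hj⟩ := hx
    simp only [one_smul, smul_zero] at hj
    rw [Submonoid.smul_def, smul_smul] at hj
    refine ⟨j + n, ?_⟩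
    rw [LocalizedModule.smul'_mk, ← LocalizedModule.zero_mk (⟨g ^ n, n, rfl⟩ : Submonoid.powers g),
      LocalizedModule.mk_eq]
    refine ⟨⟨g ^ j, j, rfl⟩, ?_⟩
    simp only [smul_zero]
    rw [Submonoid.smul_def, Submonoid.smul_def, smul_smul, smul_smul]
    have : (g ^ j * (g ^ n * b ^ (j + n)) : R) = g ^ n * ((g * b) ^ j * b ^ n) := by ring
    change ((g ^ j * g ^ n) * b ^ (j + n) : R) • m = 0
    rw [show ((g ^ j * g ^ n) * b ^ (j + n) : R) = g ^ n * ((g * b) ^ j * b ^ n) by ring, mul_smul]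
    change g ^ n • (((g * b) ^ j * b ^ n) • m) = 0
    rw [hj, smul_zero]

/-! ## The `b`-localisation of `M_{(g)}` inside `M[1/gb]` -/

/-- `b ∈ R[I/g]`. [folklore] -/
abbrev bA : blowupAlgebra I g := algebraMap R (blowupAlgebra I g) b

/-- **`N_b`**: the localisation of `N = M_{(g)}` at the powers of `b`. [folklore] -/
abbrev Nb : Type u :=
  LocalizedModule (Submonoid.powers (bA I g b)) (chartModule I g E)

/-- (Instance shortcut.) [folklore] -/
instance Nb.instAddCommGroup : AddCommGroup (Nb I g b E) :=
  inferInstanceAs (AddCommGroup (LocalizedModule _ _))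

set_option synthInstance.maxHeartbeats 80000 in
/-- (Instance shortcut.) [folklore] -/
instance Nb.instModule : Module (blowupAlgebra I g) (Nb I g b E) :=
  inferInstanceAs (Module (blowupAlgebra I g) (LocalizedModule _ _))

/-- (Instance shortcut.) [folklore] -/
instance Nb.instSMul : SMul (blowupAlgebra I g) (Nb I g b E) := (Nb.instModule I g b E).toSMul

/-- `N → N_b`. [folklore] -/
abbrev ιb : chartModule I g E →ₗ[blowupAlgebra I g] Nb I g b E :=
  LocalizedModule.mkLinearMap (Submonoid.powers (bA I g b)) (chartModule I g E)

/-- `τ` restricted to `N = M_{(g)}`, `R[I/g]`-linearly into `M[1/gb]`. [folklore] -/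
def awayMulModN : chartModule I g E →ₗ[blowupAlgebra I g] LocalizedModule (Submonoid.powers (g * b)) E where
  toFun x := awayMulMod g b E x
  map_add' x x' := by rw [Submodule.coe_add, map_add]
  map_smul' z x := by rw [RingHom.id_apply, Submodule.coe_smul, awayMulMod_smul']

/-- Unfolding `awayMulModN`. [folklore] -/
theorem awayMulModN_apply (x : chartModule I g E) :
    awayMulModN I g b E x = awayMulMod g b E x := rfl

/-- `b ∈ R[I/g]` acts on `M[1/gb]` as `b`. [folklore] -/
theorem bA_pow_smul (k : ℕ) (w : LocalizedModule (Submonoid.powers (g * b)) E) :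
    (bA I g b ^ k) • w = b ^ k • w := by
  rw [blowupAlgebra_smul_def', Subalgebra.coe_pow, Subalgebra.coe_algebraMap, ← map_pow,
    awayMul_algebraMap, algebraMap_smul]

/-- `b ∈ R[I/g]` acts on `M[1/gb]` as `b`. [folklore] -/
theorem bA_smul (w : LocalizedModule (Submonoid.powers (g * b)) E) : bA I g b • w = b • w := by
  have h := bA_pow_smul I g b E 1 w
  rwa [pow_one, pow_one] at h

/-- Powers of `b ∈ R[I/g]` act invertibly on `M[1/gb]`. [folklore] -/
theorem isUnit_algebraMap_end_bA_pow (k : ℕ) :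
    IsUnit (algebraMap (blowupAlgebra I g)
      (Module.End (blowupAlgebra I g) (LocalizedModule (Submonoid.powers (g * b)) E)) (bA I g b ^ k)) := by
  rw [Module.End.isUnit_iff]
  have h := (Module.End.isUnit_iff _).mp
    (isUnit_algebraMap_end_of_dvd g b E (r := b ^ k) (n := k)
      (pow_dvd_pow_of_dvd (dvd_mul_left b g) k))
  have hfun : (⇑((algebraMap (blowupAlgebra I g) (Module.End (blowupAlgebra I g)
      (LocalizedModule (Submonoid.powers (g * b)) E))) (bA I g b ^ k)) :
        LocalizedModule (Submonoid.powers (g * b)) E → LocalizedModule (Submonoid.powers (g * b)) E) =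
      ⇑((algebraMap R (Module.End R (LocalizedModule (Submonoid.powers (g * b)) E))) (b ^ k)) := by
    funext w
    rw [Module.algebraMap_end_apply, Module.algebraMap_end_apply, bA_pow_smul]
  rw [hfun]
  exact h

/-- **`κ : N_b → M[1/gb]`**, the `b`-localisation of `τ|_N`. [cite: Cesnavicius2021, proof of
Thm. 3.13] -/
def kappaMul : Nb I g b E →ₗ[blowupAlgebra I g] LocalizedModule (Submonoid.powers (g * b)) E :=
  IsLocalizedModule.lift (Submonoid.powers (bA I g b)) (ιb I g b E) (awayMulModN I g b E)
    fun s => by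
      obtain ⟨_, k, rfl⟩ := s
      exact isUnit_algebraMap_end_bA_pow I g b E k

/-- `κ (n/1) = τ n`. [folklore] -/
theorem kappaMul_ιb (x : chartModule I g E) :
    kappaMul I g b E (ιb I g b E x) = awayMulMod g b E x :=
  IsLocalizedModule.lift_apply _ _ _ _ x

/-- **`κ` is injective when `b` is `N`-regular.** [cite: Cesnavicius2021, proof of Thm. 3.13] -/
theorem kappaMul_injective (hbN : IsSMulRegular (chartModule I g E) (bA I g b)) :
    Function.Injective (kappaMul I g b E) := by
  rw [← LinearMap.ker_eq_bot, LinearMap.ker_eq_bot']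
  intro v hv
  induction v using LocalizedModule.induction_on with
  | h x s =>
    obtain ⟨_, k, rfl⟩ := s
    -- `bᵏ • (x/bᵏ) = x/1`, so `τ x = 0`
    have h1 : kappaMul I g b E (ιb I g b E x) = 0 := by
      have := congrArg (fun w => bA I g b ^ k • w) hv
      simp only [smul_zero, ← LinearMap.map_smul] at this
      rwa [LocalizedModule.smul'_mk, show (bA I g b ^ k • x) =
        ((⟨bA I g b ^ k, k, rfl⟩ : Submonoid.powers (bA I g b)) • x) from rfl,
        LocalizedModule.mk_cancel] at this
    rw [kappaMul_ιb] at h1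
    obtain ⟨j, hj⟩ := exists_pow_smul_eq_zero_of_awayMulMod_eq_zero g b E h1
    -- `bʲ x = 0` in `N`, so `x = 0`
    have hx : x = 0 := by
      apply hbN.pow j
      dsimp only
      rw [smul_zero]
      apply Subtype.ext
      rw [Submodule.coe_smul, Submodule.coe_zero, blowupAlgebra.smul_def, Subalgebra.coe_pow,
        Subalgebra.coe_algebraMap, ← map_pow, algebraMap_smul]
      exact hj
    rw [hx, LocalizedModule.zero_mk]

/-- **`(a/b) • κ(b v) = κ(a v)`**: on the image of `κ`, `a/b` acts as it should. [folklore] -/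
theorem aOverB_smul_kappaMul (v : Nb I g b E) :
    aOverB g b a • kappaMul I g b E (bA I g b • v) =
      kappaMul I g b E (algebraMap R (blowupAlgebra I g) a • v) := by
  rw [LinearMap.map_smul, LinearMap.map_smul, bA_smul,
    ← algebraMap_smul (Localization.Away (g * b)) b, smul_smul, aOverB_mul_algebraMap,
    algebraMap_smul]
  rw [blowupAlgebra_smul_def', Subalgebra.coe_algebraMap, awayMul_algebraMap, algebraMap_smul]

/-- **`R[I/g][T] · τ(M_{(g)}) = M_{(gb)}` inside `M[1/gb]`** (Stacks 080A on chart modules,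
Česnavičius (3.12.2)): both are the `R[IJ/gb]`-span of the image of `M`, as
`R[I/g][T] ↠ R[IJ/gb]`. [cite: Cesnavicius2021, §3.12 ((3.12.2))] [cite: StacksProject, Tag 080A] -/
theorem span_kappaMul_eq (hg : g ∈ I) (hb : b ∈ J) (ha : a ∈ J)
    (hJ : ∀ z ∈ J, ∃ α β : blowupAlgebra I g, algebraMap R (blowupAlgebra I g) z =
      α * algebraMap R (blowupAlgebra I g) a + β * algebraMap R (blowupAlgebra I g) b) :
    letI := chiModule I g b a E
    ((Submodule.span (blowupAlgebra I g)[X] (Set.range (kappaMul I g b E ∘ ιb I g b E)) :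
        Submodule (blowupAlgebra I g)[X] (LocalizedModule (Submonoid.powers (g * b)) E)) :
          Set (LocalizedModule (Submonoid.powers (g * b)) E)) =
      (chartModule (I * J) (g * b) E : Set (LocalizedModule (Submonoid.powers (g * b)) E)) := by
  letI := chiModule I g b a E
  apply Set.Subset.antisymm
  · intro w hw
    rw [SetLike.mem_coe] at hw ⊢
    induction hw using Submodule.span_induction with
    | mem w hw =>
      obtain ⟨x, rfl⟩ := hw
      rw [Function.comp_apply, kappaMul_ιb]
      exact awayMulMod_mem_chartModule I J g b E hb x.2
    | zero => exact Submodule.zero_mem _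
    | add w w' _ _ ih ih' => exact Submodule.add_mem _ ih ih'
    | smul p w _ ih =>
      rw [chi_smul_def, ← coe_rho I J g b a hg hb ha, ← blowupAlgebra.smul_def]
      exact Submodule.smul_mem _ _ ih
  · intro w hw
    rw [SetLike.mem_coe] at hw ⊢
    induction hw using Submodule.span_induction with
    | mem w hw =>
      obtain ⟨m, rfl⟩ := hw
      rw [← awayMulMod_mkLinearMap, ← kappaMul_ιb I g b E ⟨_, mkLinearMap_mem_chartModule I g m⟩]
      exact Submodule.subset_span ⟨⟨_, mkLinearMap_mem_chartModule I g m⟩, rfl⟩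
    | zero => exact Submodule.zero_mem _
    | add w w' _ _ ih ih' => exact Submodule.add_mem _ ih ih'
    | smul z w _ ih =>
      obtain ⟨p, rfl⟩ := rho_surjective I J g b a hg hb ha hJ z
      rw [blowupAlgebra.smul_def, coe_rho, ← chi_smul_def]
      exact Submodule.smul_mem _ _ ih

/-! ## The inductive step, read on `M_{(gb)}` -/

/-- **Kawasaki's inductive step on chart modules** (Česnavičius 2021, proof of Thm. 3.13, all of
(punch-1)–(punch-5) and (bam-1)–(bam-4) combined with Stacks 080A): let `g ∈ I`, `a, b ∈ J` with
`J R[I/g] ⊆ (a, b)R[I/g]`, `N = M_{(g)}` with `b` `N`-regular, `y` a family in `R[I/g]` with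
`a, b ∈ √(y)`, `φ : N_b/N → W` with `a` bijective on `W` and `a, b` killing `ker φ`,
`Hʲ_{(y)}(ker φ) = Hʲ_{(y)}(W/im φ) = 0` for `j < n`, and `f ∈ R[I/g][T]` monic. Then for every
family `y'` of elements of `R[IJ/gb]` generating the image of `(f, y)` under `T ↦ a/b`,
`Hʲ_{(y')}(M_{(gb)}) = 0` for `j < n + 2`. [cite: Cesnavicius2021, Thm. 3.13, proof]
[cite: Kawasaki2000, Thm. 4.1] -/
theorem cechVanishBelow_chartModule_mul [IsNoetherianRing R] [Module.Finite R E]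
    (hg : g ∈ I) (hb : b ∈ J) (ha : a ∈ J)
    (hJ : ∀ z ∈ J, ∃ α β : blowupAlgebra I g, algebraMap R (blowupAlgebra I g) z =
      α * algebraMap R (blowupAlgebra I g) a + β * algebraMap R (blowupAlgebra I g) b)
    (hbN : IsSMulRegular (chartModule I g E) (bA I g b))
    {s : ℕ} {y : Fin s → blowupAlgebra I g}
    (ha' : algebraMap R (blowupAlgebra I g) a ∈ (Ideal.span (Set.range y)).radical)
    (hb' : bA I g b ∈ (Ideal.span (Set.range y)).radical)
    {W : Type u} [AddCommGroup W] [Module (blowupAlgebra I g) W]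
    (hW : Function.Bijective fun w : W => algebraMap R (blowupAlgebra I g) a • w)
    (φ : (Nb I g b E ⧸ LinearMap.range (ιb I g b E)) →ₗ[blowupAlgebra I g] W)
    (hker : ∀ v ∈ LinearMap.ker φ, algebraMap R (blowupAlgebra I g) a • v = 0 ∧ bA I g b • v = 0)
    {n : ℕ} (hE1 : CechVanishBelow y (LinearMap.ker φ) n)
    (hE2 : CechVanishBelow y (W ⧸ LinearMap.range φ) n)
    {f : (blowupAlgebra I g)[X]} (hf : f.Monic)
    {s' : ℕ} {y' : Fin s' → blowupAlgebra (I * J) (g * b)}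
    (hy' : Ideal.span (Set.range y') =
      (Ideal.span (Set.range (Fin.cons f (yB (blowupAlgebra I g)[X] y) :
        Fin (s + 1) → (blowupAlgebra I g)[X]))).map (rho I J g b a hg hb ha)) :
    CechVanishBelow y' (chartModule (I * J) (g * b) E) (n + 2) := by
  letI := chiModule I g b a E
  haveI := isScalarTower_chi I g b a E
  -- the step, on the `R[I/g][T]`-module `R[I/g][T] · κ(N)`
  have hκX : ∀ v : Nb I g b E, (X : (blowupAlgebra I g)[X]) • kappaMul I g b E (bA I g b • v) =
      kappaMul I g b E (algebraMap R (blowupAlgebra I g) a • v) := fun v => by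
    rw [chi_smul_def, chi_X]; exact aOverB_smul_kappaMul I g b a E v
  have h := cechVanishBelow_span_of_chart (ιb I g b E) (algebraMap R (blowupAlgebra I g) a)
    (bA I g b) ha' hb' hW φ hker hE1 hE2 hf (kappaMul I g b E) (kappaMul_injective I g b E hbN)
    hκX
  -- move to `M_{(gb)}` with its `R[IJ/gb]`-structure
  set A' := blowupAlgebra (I * J) (g * b) with hA'
  letI : Algebra (blowupAlgebra I g)[X] A' := (rho I J g b a hg hb ha).toAlgebra
  haveI : IsScalarTower (blowupAlgebra I g)[X] A' (LocalizedModule (Submonoid.powers (g * b)) E) :=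
    ⟨fun p z w => by
      rw [Algebra.smul_def, blowupAlgebra.smul_def, Subalgebra.coe_mul, mul_smul, chi_smul_def,
        ← coe_rho I J g b a hg hb ha]
      rfl⟩
  let e : Submodule.span (blowupAlgebra I g)[X] (Set.range (kappaMul I g b E ∘ ιb I g b E)) ≃ₗ[
      (blowupAlgebra I g)[X]] chartModule (I * J) (g * b) E :=
    { toFun := fun x => ⟨x.1, by
        rw [← SetLike.mem_coe, ← span_kappaMul_eq I J g b a E hg hb ha hJ]; exact x.2⟩
      invFun := fun x => ⟨x.1, by
        rw [← SetLike.mem_coe, span_kappaMul_eq I J g b a E hg hb ha hJ]; exact x.2⟩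
      left_inv := fun _ => rfl
      right_inv := fun _ => rfl
      map_add' := fun _ _ => rfl
      map_smul' := fun _ _ => rfl }
  have h2 := h.of_equiv e
  have h3 := (cechVanishBelow_yB_iff (Fin.cons f (yB (blowupAlgebra I g)[X] y) :
    Fin (s + 1) → (blowupAlgebra I g)[X]) (chartModule (I * J) (g * b) E) A').mpr h2
  -- generators
  haveI : IsNoetherianRing A' := isNoetherianRing_blowupAlgebra_of_isNoetherianRing _ _
  refine h3.of_span_eq ?_
  rw [hy', Ideal.map_span, ← Set.range_comp]
  rfl

end Modules

end Literature.AlgebraicGeometry.Resolution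

end
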